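import Mathlib
import HarnessLib
import Summits.Ventures.LatticeQCDFlow.Scoring.MartingaleArrayCLT
import Summits.Ventures.LatticeQCDFlow.Scoring.BlockQuarticVariationLLN

/-!
# THE CENTRAL LIMIT THEOREM FOR THE SQUARED BLOCK MARTINGALES OF THE BATCH-MEANS ESTIMATOR, from
# any start: `(Σ_{j<a} (M_{bj,b}² − Σ_{i<b} q(X_{bj+i}))) / (√a · b) ⇒ N(0, 2σ⁴)` as `a, b → ∞`

HONEST FRAMING: exact (Metropolis-corrected) sampling algorithms for lattice gauge theory;
figures of merit are autocorrelation/cost numbers at stated couplings and volumes; no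
continuum-physics claim.

Venture `LatticeQCDFlow` (cell pub-lqcd), topic `Scoring`; FANOUT row 4 (`s0-u1-b`, GEN-30).
NEW WORK of the cell, not a published result; no definition is introduced; nothing is cited as a
fact.  Notation of `Scoring/BlockMartingaleSqIncrements.lean` (`P_{μ₀}` from ANY initial law,
`|h| ≤ C_h` measurable, `M_{s,b}` the block martingale of the increments `D_t = h(X_{t+1}) − kop κ h(X_t)`,
`q = kop κ (h²) − (kop κ h)²`, `η_{s,i}`) under row 8's geometric envelope `(A, ρ)`; `σ² := ∫ q dπ`
(the Green–Kubo variance when `h` solves the Poisson equation,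
`Scoring/GeometricEnvelopeBlockSumMoments.poisson_condVar_integral_eq_greenKubo_of_envelope`).
THE THEOREM OF THIS FILE is the martingale heart of the sampling law of the batch-means estimator
`σ̂²_{a,b}` (row 4's `τ_int` column): for EVERY initial law and EVERY pair of sequences
`a_n → ∞`, `b_n → ∞`,
`(Σ_{j<a_n} (M_{b_n j, b_n}² − Σ_{i<b_n} q(X_{b_n j+i}))) / (√a_n · b_n) ⇒ N(0, 2σ⁴)`.
Proof: by the telescoping identity the statistic is the ROW SUM `Σ_{t < a_n b_n} ζ_{n,t}` of the
array `ζ_{n,t} = η_{b⌊t/b⌋, t mod b}/(√a b)` (`sum_range_mul_div_mod`); the increments are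
measurable, bounded by `8 C_h²/√a_n → 0` and orthogonal to every bounded measurable function of the
earlier increments (`chain_sqIncr_orthogonal`, the earlier increments depend on coordinates `≤ t`);
the quadratic variation `Σ_t ζ_{n,t}² = (Σ_j Σ_i η_{bj,i}²)/(a b²) → 2σ⁴` in probability
(`Scoring/BlockQuarticVariationLLN.lean`); McLeish's array CLT (`Scoring/MartingaleArrayCLT.lean`)
concludes.

## Content

* `sum_range_mul_div_mod` — `Σ_{t<ab} f(b⌊t/b⌋, t mod b) = Σ_{j<a} Σ_{i<b} f(bj, i)`;
* **`chain_sqBlockMartingale_centred_clt_of_envelope`** — THE THEOREM above.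

NOT CLAIMED: the boundary and centring terms that turn this into the CLT for `σ̂²_{a,b}` itself
(`Scoring/BatchMeansCLT.lean`); rates; unbounded `h`.
-/

noncomputable section

namespace Summit.Ventures.LatticeQCDFlow.Scoring

open MeasureTheory ProbabilityTheory Filter Finset Preorder
open scoped ENNReal Topology

variable {Ω : Type*} [MeasurableSpace Ω]

/-- `Σ_{t < a b} f(b ⌊t/b⌋, t mod b) = Σ_{j<a} Σ_{i<b} f(bj, i)`. -/
theorem sum_range_mul_div_mod {M : Type*} [AddCommMonoid M] (f : ℕ → ℕ → M) (a b : ℕ) :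
    ∑ t ∈ Finset.range (a * b), f (b * (t / b)) (t % b)
      = ∑ j ∈ Finset.range a, ∑ i ∈ Finset.range b, f (b * j) i := by
  rcases Nat.eq_zero_or_pos b with hb | hb
  · subst hb; simp
  induction a with
  | zero => simp
  | succ a ih =>
    rw [Nat.succ_mul, Finset.sum_range_add, ih, Finset.sum_range_succ]
    congr 1
    refine Finset.sum_congr rfl fun i hi => ?_
    have hi' := Finset.mem_range.1 hi
    rw [show a * b + i = b * a + i by ring, Nat.mul_add_div hb, Nat.div_eq_of_lt hi', add_zero,
      Nat.mul_add_mod, Nat.mod_eq_of_lt hi']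

section Envelope

variable {κ : Kernel Ω Ω} [IsMarkovKernel κ] {π : Measure Ω} [IsProbabilityMeasure π] {A ρ : ℝ}

/-- **THE CLT FOR THE CENTRED SQUARED BLOCK MARTINGALES, FROM ANY START.**  Envelope `(A, ρ)`
(`0 ≤ A`, `0 ≤ ρ < 1`), `|h| ≤ C_h` measurable, `σ² = ∫ q dπ`; `a_n → ∞`, `b_n → ∞`; `μ₀` ANY initial
law.  For every real random variable `Y` with law `N(0, 2σ⁴)`:
`TendstoInDistribution (fun n x => (Σ_{j<a_n} (M_{b_n j,b_n}(x)² − Σ_{i<b_n} q(x_{b_n j+i})))/(√a_n b_n))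
  atTop Y (fun _ => P_{μ₀}) P'`. -/
theorem chain_sqBlockMartingale_centred_clt_of_envelope
    (henv : ∀ (g : Ω → ℝ), Measurable g → ∀ (Cg : ℝ), (∀ x, |g x| ≤ Cg) →
      ∀ (t : ℕ) (x : Ω), |(kop κ)^[t] g x - ∫ y, g y ∂π| ≤ 2 * Cg * (A * ρ ^ t))
    (hA : 0 ≤ A) (hρ0 : 0 ≤ ρ) (hρ1 : ρ < 1)
    {h : Ω → ℝ} (hh : Measurable h) {Ch : ℝ} (hCh : ∀ x, |h x| ≤ Ch)
    (μ₀ : Measure Ω) [IsProbabilityMeasure μ₀] {a b : ℕ → ℕ} (ha : Tendsto a atTop atTop)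
    (hb : Tendsto b atTop atTop)
    {Ω' : Type*} [MeasurableSpace Ω'] {P' : Measure Ω'} [IsProbabilityMeasure P'] {Y : Ω' → ℝ}
    (hY : HasLaw Y (gaussianReal 0 (Real.toNNReal (2 * (∫ y, (kop κ (fun y => h y ^ 2) y - (kop κ h y) ^ 2) ∂π) ^ 2))) P')
    [IsProbabilityMeasure (Kernel.trajMeasure (X := fun _ : ℕ => Ω) (μ₀)
          (fun n : ℕ => κ.comap (fun h' : (i : ↥(Finset.Iic n)) → Ω => h' ⟨n, Finset.mem_Iic.2 le_rfl⟩)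
            (measurable_pi_apply _)))] :
    TendstoInDistribution (fun (n : ℕ) (x : ℕ → Ω) =>
        (∑ j ∈ Finset.range (a n), ((∑ r ∈ Finset.range (b n), (h (x (b n * j + r + 1)) - kop κ h (x (b n * j + r)))) ^ 2
          - ∑ i ∈ Finset.range (b n), (kop κ (fun y => h y ^ 2) (x (b n * j + i)) - (kop κ h (x (b n * j + i))) ^ 2))) / (Real.sqrt (a n) * (b n)))
      atTop Y (fun _ => (Kernel.trajMeasure (X := fun _ : ℕ => Ω) (μ₀)
            (fun n : ℕ => κ.comap (fun h' : (i : ↥(Finset.Iic n)) → Ω => h' ⟨n, Finset.mem_Iic.2 le_rfl⟩)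
              (measurable_pi_apply _)))) P' := by
  set P := (Kernel.trajMeasure (X := fun _ : ℕ => Ω) (μ₀)
        (fun n : ℕ => κ.comap (fun h' : (i : ↥(Finset.Iic n)) → Ω => h' ⟨n, Finset.mem_Iic.2 le_rfl⟩)
          (measurable_pi_apply _))) with hP
  set m : ℝ := ∫ y, (kop κ (fun y => h y ^ 2) y - (kop κ h y) ^ 2) ∂π with hm
  have hC0 : 0 ≤ Ch := (abs_nonneg _).trans (hCh (Classical.choice
    (nonempty_of_isProbabilityMeasure μ₀)))
  -- the array
  set ζ : ℕ → ℕ → (ℕ → Ω) → ℝ := fun n t x =>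
    (2 * (∑ r ∈ Finset.range (t % b n), (h (x (b n * (t / b n) + r + 1)) - kop κ h (x (b n * (t / b n) + r)))) * (h (x (b n * (t / b n) + t % b n + 1)) - kop κ h (x (b n * (t / b n) + t % b n))) + ((h (x (b n * (t / b n) + t % b n + 1)) - kop κ h (x (b n * (t / b n) + t % b n))) ^ 2 - (kop κ (fun y => h y ^ 2) (x (b n * (t / b n) + t % b n)) - (kop κ h (x (b n * (t / b n) + t % b n))) ^ 2))) / (Real.sqrt (a n) * (b n)) with hζ
  -- (i) measurability
  have hζm : ∀ n t, Measurable (ζ n t) := fun n t =>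
    (measurable_sqIncr κ hh _ _).div_const _
  -- (ii) uniform smallness
  have hc : ∀ n t x, |ζ n t x| ≤ 8 * Ch ^ 2 / Real.sqrt (a n) := by
    intro n t x
    simp only [hζ]
    rcases Nat.eq_zero_or_pos (b n) with hb0 | hb0
    · rw [hb0, Nat.cast_zero, mul_zero, div_zero, abs_zero]; positivity
    rcases Nat.eq_zero_or_pos (a n) with ha0 | ha0
    · rw [ha0, Nat.cast_zero, Real.sqrt_zero, zero_mul, div_zero, abs_zero, div_zero]
    have hsa : 0 < Real.sqrt (a n) := Real.sqrt_pos.2 (Nat.cast_pos.2 ha0)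
    have hbR : (0 : ℝ) < b n := Nat.cast_pos.2 hb0
    rw [abs_div, abs_of_pos (mul_pos hsa hbR), div_le_div_iff₀ (mul_pos hsa hbR) hsa]
    have h1 := abs_sqIncr_le κ hh hCh (b n * (t / b n)) (t % b n) x
    have h2 : ((t % b n : ℕ) : ℝ) + 1 ≤ b n := by exact_mod_cast Nat.mod_lt t hb0
    calc |(2 * (∑ r ∈ Finset.range (t % b n), (h (x (b n * (t / b n) + r + 1)) - kop κ h (x (b n * (t / b n) + r)))) * (h (x (b n * (t / b n) + t % b n + 1)) - kop κ h (x (b n * (t / b n) + t % b n))) + ((h (x (b n * (t / b n) + t % b n + 1)) - kop κ h (x (b n * (t / b n) + t % b n))) ^ 2 - (kop κ (fun y => h y ^ 2) (x (b n * (t / b n) + t % b n)) - (kop κ h (x (b n * (t / b n) + t % b n))) ^ 2)))| * Real.sqrt (a n)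
        ≤ 8 * Ch ^ 2 * (((t % b n : ℕ) : ℝ) + 1) * Real.sqrt (a n) :=
          mul_le_mul_of_nonneg_right h1 hsa.le
      _ ≤ 8 * Ch ^ 2 * (b n) * Real.sqrt (a n) := by gcongr
      _ = 8 * Ch ^ 2 * (Real.sqrt (a n) * (b n)) := by ring
  have hc0 : Tendsto (fun n => 8 * Ch ^ 2 / Real.sqrt (a n)) atTop (𝓝 0) :=
    tendsto_const_nhds.div_atTop (Real.tendsto_sqrt_atTop.comp
      ((tendsto_natCast_atTop_atTop (R := ℝ)).comp ha))
  -- (iii) orthogonality to the past increments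
  have horth : ∀ (n t : ℕ) (F : (Fin t → ℝ) → ℝ) (K' : ℝ), Measurable F → (∀ w, |F w| ≤ K') →
      ∫ x, F (fun i => ζ n i x) * ζ n t x ∂P = 0 := by
    intro n t F K' hF hFb
    have hst : b n * (t / b n) + t % b n = t := Nat.div_add_mod t (b n)
    have hGm : Measurable fun x : ℕ → Ω => F (fun i : Fin t => ζ n i x) :=
      hF.comp (measurable_pi_lambda _ fun i => hζm n i)
    have hGd : DependsOn (fun x : ℕ → Ω => F (fun i : Fin t => ζ n i x))
        (Set.Iic (b n * (t / b n) + t % b n)) := by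
      rw [hst]
      intro x y hxy
      show F (fun i : Fin t => ζ n i x) = F (fun i : Fin t => ζ n i y)
      congr 1
      funext i
      simp only [hζ]
      have hi : b n * ((i : ℕ) / b n) + (i : ℕ) % b n + 1 ≤ t := by
        rw [Nat.div_add_mod]; exact i.2
      have hdep := sqIncr_dependsOn (kop κ) h (fun z => (kop κ (fun y => h y ^ 2) z - (kop κ h z) ^ 2)) (b n * ((i : ℕ) / b n))
        ((i : ℕ) % b n) (x := x) (y := y) fun j hj => hxy j (Set.mem_Iic.2
          ((Set.mem_Iic.1 hj).trans hi))
      dsimp only at hdep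
      rw [hdep]
    have key := chain_sqIncr_orthogonal κ μ₀ hh hCh (b n * (t / b n)) (t % b n) hGm hGd
      (fun x => hFb _)
    rw [← hP] at key
    have : ∀ x : ℕ → Ω, F (fun i : Fin t => ζ n i x) * ζ n t x
        = F (fun i : Fin t => ζ n i x) * (2 * (∑ r ∈ Finset.range (t % b n), (h (x (b n * (t / b n) + r + 1)) - kop κ h (x (b n * (t / b n) + r)))) * (h (x (b n * (t / b n) + t % b n + 1)) - kop κ h (x (b n * (t / b n) + t % b n))) + ((h (x (b n * (t / b n) + t % b n + 1)) - kop κ h (x (b n * (t / b n) + t % b n))) ^ 2 - (kop κ (fun y => h y ^ 2) (x (b n * (t / b n) + t % b n)) - (kop κ h (x (b n * (t / b n) + t % b n))) ^ 2)))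
          / (Real.sqrt (a n) * (b n)) := fun x => by simp only [hζ]; ring
    simp_rw [this, integral_div, key, zero_div]
  -- (iv) the quadratic variation
  have hQVeq : ∀ n x, ∑ t ∈ Finset.range (a n * b n), ζ n t x ^ 2
      = (∑ j ∈ Finset.range (a n), (∑ i ∈ Finset.range (b n), (2 * (∑ r ∈ Finset.range i, (h (x (b n * j + r + 1)) - kop κ h (x (b n * j + r)))) * (h (x (b n * j + i + 1)) - kop κ h (x (b n * j + i))) + ((h (x (b n * j + i + 1)) - kop κ h (x (b n * j + i))) ^ 2 - (kop κ (fun y => h y ^ 2) (x (b n * j + i)) - (kop κ h (x (b n * j + i))) ^ 2))) ^ 2)) / ((a n : ℝ) * (b n : ℝ) ^ 2) := by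
    intro n x
    simp only [hζ]
    rw [sum_range_mul_div_mod (fun s i => ((2 * (∑ r ∈ Finset.range i, (h (x (s + r + 1)) - kop κ h (x (s + r)))) * (h (x (s + i + 1)) - kop κ h (x (s + i))) + ((h (x (s + i + 1)) - kop κ h (x (s + i))) ^ 2 - (kop κ (fun y => h y ^ 2) (x (s + i)) - (kop κ h (x (s + i))) ^ 2))) / (Real.sqrt (a n) * (b n))) ^ 2) (a n) (b n)]
    rw [Finset.sum_div]
    refine Finset.sum_congr rfl fun j _ => ?_
    rw [Finset.sum_div]
    refine Finset.sum_congr rfl fun i _ => ?_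
    rw [div_pow, mul_pow, Real.sq_sqrt (Nat.cast_nonneg _)]
  have hQV : TendstoInMeasure P (fun n x => ∑ t ∈ Finset.range (a n * b n), ζ n t x ^ 2) atTop
      (fun _ => 2 * m ^ 2) := by
    have h := chain_quarticVariation_tendstoInMeasure_of_envelope henv hA hρ0 hρ1 hh hCh μ₀ ha hb
    rw [← hP, ← hm] at h
    refine h.congr (fun n => Eventually.of_forall fun x => (hQVeq n x).symm) (Eventually.of_forall
      fun _ => rfl)
  -- (v) McLeish
  have hv : (0 : ℝ) ≤ 2 * m ^ 2 := by positivity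
  have hclt := tendstoInDistribution_rowSum_of_orthogonal (P := P) (k := fun n => a n * b n) hζm hc
    hc0 horth hv hQV hY
  -- (vi) identify the row sums with the statistic
  have hrow : ∀ n x, ∑ t ∈ Finset.range (a n * b n), ζ n t x
      = (∑ j ∈ Finset.range (a n), ((∑ r ∈ Finset.range (b n), (h (x (b n * j + r + 1)) - kop κ h (x (b n * j + r)))) ^ 2
          - ∑ i ∈ Finset.range (b n), (kop κ (fun y => h y ^ 2) (x (b n * j + i)) - (kop κ h (x (b n * j + i))) ^ 2))) / (Real.sqrt (a n) * (b n)) := by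
    intro n x
    simp only [hζ]
    rw [sum_range_mul_div_mod (fun s i => (2 * (∑ r ∈ Finset.range i, (h (x (s + r + 1)) - kop κ h (x (s + r)))) * (h (x (s + i + 1)) - kop κ h (x (s + i))) + ((h (x (s + i + 1)) - kop κ h (x (s + i))) ^ 2 - (kop κ (fun y => h y ^ 2) (x (s + i)) - (kop κ h (x (s + i))) ^ 2))) / (Real.sqrt (a n) * (b n))) (a n) (b n),
      Finset.sum_div]
    refine Finset.sum_congr rfl fun j _ => ?_
    rw [← Finset.sum_div, sqIncr_sum_eq (kop κ) h (fun z => (kop κ (fun y => h y ^ 2) z - (kop κ h z) ^ 2)) x (b n * j) (b n)]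
  have hfun : (fun (n : ℕ) (x : ℕ → Ω) =>
      (∑ j ∈ Finset.range (a n), ((∑ r ∈ Finset.range (b n), (h (x (b n * j + r + 1)) - kop κ h (x (b n * j + r)))) ^ 2
        - ∑ i ∈ Finset.range (b n), (kop κ (fun y => h y ^ 2) (x (b n * j + i)) - (kop κ h (x (b n * j + i))) ^ 2))) / (Real.sqrt (a n) * (b n)))
      = fun (n : ℕ) (x : ℕ → Ω) => ∑ t ∈ Finset.range (a n * b n), ζ n t x := by
    funext n x; exact (hrow n x).symm
  rw [hfun]
  exact hclt

end Envelope

/-! ### The second moment of the martingale statistic (GEN-31) -/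

section SecondMoment

/-- **Pythagoras for a finite sequence orthogonal to its past**: bounded measurable `Z_t` with
`∫ Z_s Z_t dμ = 0` for `s < t` satisfy `∫ (Σ_{t<n} Z_t)² dμ = Σ_{t<n} ∫ Z_t² dμ`. -/
theorem integral_sq_sum_eq_of_orthogonal {Ω₀ : Type*} [MeasurableSpace Ω₀] (μ : Measure Ω₀)
    [IsProbabilityMeasure μ] {Z : ℕ → Ω₀ → ℝ} (hZm : ∀ t, Measurable (Z t)) {CZ : ℕ → ℝ}
    (hZb : ∀ t x, |Z t x| ≤ CZ t) (horth : ∀ s t, s < t → ∫ x, Z s x * Z t x ∂μ = 0) (n : ℕ) :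
    ∫ x, (∑ t ∈ Finset.range n, Z t x) ^ 2 ∂μ = ∑ t ∈ Finset.range n, ∫ x, Z t x ^ 2 ∂μ := by
  induction n with
  | zero => simp
  | succ n ih =>
    have hSm : Measurable fun x => ∑ t ∈ Finset.range n, Z t x :=
      Finset.measurable_sum _ fun t _ => hZm t
    have hSb : ∀ x, |∑ t ∈ Finset.range n, Z t x| ≤ ∑ t ∈ Finset.range n, CZ t := fun x =>
      (Finset.abs_sum_le_sum_abs _ _).trans (Finset.sum_le_sum fun t _ => hZb t x)
    have i1 : Integrable (fun x => (∑ t ∈ Finset.range n, Z t x) ^ 2) μ :=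
      integrable_of_bounded μ (hSm.pow_const 2) (C := (∑ t ∈ Finset.range n, CZ t) ^ 2) fun x => by
        rw [abs_pow]; exact pow_le_pow_left₀ (abs_nonneg _) (hSb x) 2
    have i2 : Integrable (fun x => 2 * ((∑ t ∈ Finset.range n, Z t x) * Z n x)) μ :=
      (integrable_of_bounded μ (show Measurable (fun x => (∑ t ∈ Finset.range n, Z t x) * Z n x) from
          hSm.mul (hZm n)) (C := (∑ t ∈ Finset.range n, CZ t) * CZ n) fun x => by
        rw [abs_mul]
        exact mul_le_mul (hSb x) (hZb n x) (abs_nonneg _) ((abs_nonneg _).trans (hSb x))).const_mul 2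
    have i12 : Integrable (fun x => (∑ t ∈ Finset.range n, Z t x) ^ 2
        + 2 * ((∑ t ∈ Finset.range n, Z t x) * Z n x)) μ := i1.add i2
    have i3 : Integrable (fun x => Z n x ^ 2) μ :=
      integrable_of_bounded μ ((hZm n).pow_const 2) (C := CZ n ^ 2) fun x => by
        rw [abs_pow]; exact pow_le_pow_left₀ (abs_nonneg _) (hZb n x) 2
    have hcross : ∫ x, (∑ t ∈ Finset.range n, Z t x) * Z n x ∂μ = 0 := by
      have hpt : ∀ x, (∑ t ∈ Finset.range n, Z t x) * Z n x = ∑ t ∈ Finset.range n, Z t x * Z n x :=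
        fun x => Finset.sum_mul _ _ _
      have hint : ∀ t ∈ Finset.range n, Integrable (fun x => Z t x * Z n x) μ := fun t _ =>
        integrable_of_bounded μ (show Measurable (fun x => Z t x * Z n x) from (hZm t).mul (hZm n))
          (C := CZ t * CZ n) fun x => by
          rw [abs_mul]
          exact mul_le_mul (hZb t x) (hZb n x) (abs_nonneg _) ((abs_nonneg _).trans (hZb t x))
      rw [integral_congr_ae (ae_of_all _ hpt), integral_finsetSum _ hint]
      exact Finset.sum_eq_zero fun t ht => horth t n (Finset.mem_range.1 ht)
    have hexp : ∀ x, (∑ t ∈ Finset.range (n + 1), Z t x) ^ 2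
        = (∑ t ∈ Finset.range n, Z t x) ^ 2 + 2 * ((∑ t ∈ Finset.range n, Z t x) * Z n x) + Z n x ^ 2 :=
      fun x => by rw [Finset.sum_range_succ]; ring
    rw [integral_congr_ae (ae_of_all _ hexp), integral_add i12 i3, integral_add i1 i2, integral_const_mul,
      hcross, ih, Finset.sum_range_succ]
    ring

variable {κ : Kernel Ω Ω} [IsMarkovKernel κ]

/-- **THE SECOND MOMENT OF THE MARTINGALE STATISTIC IS THE MEAN QUADRATIC VARIATION**: for `h`
bounded measurable, every initial law and every `a, b`,
`E_{μ₀}[(Σ_{j<a} (M_{bj,b}² − Σ_{i<b} q(X_{bj+i})))²] = Σ_{j<a} Σ_{i<b} E_{μ₀}[η_{bj,i}²]`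
(the increments `η` are orthogonal to their past). -/
theorem chain_sqBlockMartingale_centred_sq_integral_eq {h : Ω → ℝ} (hh : Measurable h) {Ch : ℝ}
    (hCh : ∀ x, |h x| ≤ Ch) (μ₀ : Measure Ω) [IsProbabilityMeasure μ₀] (a b : ℕ) :
    ∫ x, (∑ j ∈ Finset.range a, ((∑ r ∈ Finset.range b, (h (x (b * j + r + 1)) - kop κ h (x (b * j + r)))) ^ 2
          - ∑ i ∈ Finset.range b, (kop κ (fun y => h y ^ 2) (x (b * j + i)) - (kop κ h (x (b * j + i))) ^ 2))) ^ 2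
        ∂(Kernel.trajMeasure (X := fun _ : ℕ => Ω) (μ₀)
          (fun n : ℕ => κ.comap (fun h' : (i : ↥(Finset.Iic n)) → Ω => h' ⟨n, Finset.mem_Iic.2 le_rfl⟩)
            (measurable_pi_apply _)))
      = ∑ j ∈ Finset.range a, ∑ i ∈ Finset.range b,
          ∫ x, (2 * (∑ r ∈ Finset.range (i), (h (x (b * j + r + 1)) - kop κ h (x (b * j + r)))) * (h (x (b * j + (i) + 1)) - kop κ h (x (b * j + (i)))) + ((h (x (b * j + (i) + 1)) - kop κ h (x (b * j + (i)))) ^ 2 - (kop κ (fun y => h y ^ 2) (x (b * j + (i))) - (kop κ h (x (b * j + (i)))) ^ 2))) ^ 2 ∂(Kernel.trajMeasure (X := fun _ : ℕ => Ω) (μ₀)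
          (fun n : ℕ => κ.comap (fun h' : (i : ↥(Finset.Iic n)) → Ω => h' ⟨n, Finset.mem_Iic.2 le_rfl⟩)
            (measurable_pi_apply _))) := by
  set P := (Kernel.trajMeasure (X := fun _ : ℕ => Ω) (μ₀)
          (fun n : ℕ => κ.comap (fun h' : (i : ↥(Finset.Iic n)) → Ω => h' ⟨n, Finset.mem_Iic.2 le_rfl⟩)
            (measurable_pi_apply _))) with hP
  -- orthogonality of the flattened increments
  have horth : ∀ s t : ℕ, s < t →
      ∫ x, (2 * (∑ r ∈ Finset.range (s % b), (h (x (b * (s / b) + r + 1)) - kop κ h (x (b * (s / b) + r)))) * (h (x (b * (s / b) + (s % b) + 1)) - kop κ h (x (b * (s / b) + (s % b)))) + ((h (x (b * (s / b) + (s % b) + 1)) - kop κ h (x (b * (s / b) + (s % b)))) ^ 2 - (kop κ (fun y => h y ^ 2) (x (b * (s / b) + (s % b))) - (kop κ h (x (b * (s / b) + (s % b)))) ^ 2)))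
        * (2 * (∑ r ∈ Finset.range (t % b), (h (x (b * (t / b) + r + 1)) - kop κ h (x (b * (t / b) + r)))) * (h (x (b * (t / b) + (t % b) + 1)) - kop κ h (x (b * (t / b) + (t % b)))) + ((h (x (b * (t / b) + (t % b) + 1)) - kop κ h (x (b * (t / b) + (t % b)))) ^ 2 - (kop κ (fun y => h y ^ 2) (x (b * (t / b) + (t % b))) - (kop κ h (x (b * (t / b) + (t % b)))) ^ 2))) ∂P = 0 := by
    intro s t hst
    have hs : b * (s / b) + s % b = s := Nat.div_add_mod s b
    have ht : b * (t / b) + t % b = t := Nat.div_add_mod t b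
    have hle : b * (s / b) + s % b + 1 ≤ b * (t / b) + t % b := by rw [hs, ht]; omega
    have hGd := (sqIncr_dependsOn (kop κ) h (fun z => (kop κ (fun y => h y ^ 2) z - (kop κ h z) ^ 2))
      (b * (s / b)) (s % b)).mono (Set.Iic_subset_Iic.2 hle)
    have key := chain_sqIncr_orthogonal κ μ₀ hh hCh (b * (t / b)) (t % b)
      (measurable_sqIncr κ hh (b * (s / b)) (s % b)) hGd (fun x => abs_sqIncr_le κ hh hCh _ _ x)
    rw [← hP] at key
    exact key
  -- both sides as the flattened array
  have hL : ∀ x : ℕ → Ω, (∑ j ∈ Finset.range a, ((∑ r ∈ Finset.range b, (h (x (b * j + r + 1)) - kop κ h (x (b * j + r)))) ^ 2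
        - ∑ i ∈ Finset.range b, (kop κ (fun y => h y ^ 2) (x (b * j + i)) - (kop κ h (x (b * j + i))) ^ 2)))
      = ∑ t ∈ Finset.range (a * b), (2 * (∑ r ∈ Finset.range (t % b), (h (x (b * (t / b) + r + 1)) - kop κ h (x (b * (t / b) + r)))) * (h (x (b * (t / b) + (t % b) + 1)) - kop κ h (x (b * (t / b) + (t % b)))) + ((h (x (b * (t / b) + (t % b) + 1)) - kop κ h (x (b * (t / b) + (t % b)))) ^ 2 - (kop κ (fun y => h y ^ 2) (x (b * (t / b) + (t % b))) - (kop κ h (x (b * (t / b) + (t % b)))) ^ 2))) := by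
    intro x
    rw [sum_range_mul_div_mod (fun s i => (2 * (∑ r ∈ Finset.range (i), (h (x (s + r + 1)) - kop κ h (x (s + r)))) * (h (x (s + (i) + 1)) - kop κ h (x (s + (i)))) + ((h (x (s + (i) + 1)) - kop κ h (x (s + (i)))) ^ 2 - (kop κ (fun y => h y ^ 2) (x (s + (i))) - (kop κ h (x (s + (i)))) ^ 2)))) a b]
    refine Finset.sum_congr rfl fun j _ => ?_
    exact (sqIncr_sum_eq (kop κ) h (fun z => (kop κ (fun y => h y ^ 2) z - (kop κ h z) ^ 2)) x (b * j) b).symm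
  have hR : ∑ j ∈ Finset.range a, ∑ i ∈ Finset.range b, ∫ x, (2 * (∑ r ∈ Finset.range (i), (h (x (b * j + r + 1)) - kop κ h (x (b * j + r)))) * (h (x (b * j + (i) + 1)) - kop κ h (x (b * j + (i)))) + ((h (x (b * j + (i) + 1)) - kop κ h (x (b * j + (i)))) ^ 2 - (kop κ (fun y => h y ^ 2) (x (b * j + (i))) - (kop κ h (x (b * j + (i)))) ^ 2))) ^ 2 ∂P
      = ∑ t ∈ Finset.range (a * b), ∫ x, (2 * (∑ r ∈ Finset.range (t % b), (h (x (b * (t / b) + r + 1)) - kop κ h (x (b * (t / b) + r)))) * (h (x (b * (t / b) + (t % b) + 1)) - kop κ h (x (b * (t / b) + (t % b)))) + ((h (x (b * (t / b) + (t % b) + 1)) - kop κ h (x (b * (t / b) + (t % b)))) ^ 2 - (kop κ (fun y => h y ^ 2) (x (b * (t / b) + (t % b))) - (kop κ h (x (b * (t / b) + (t % b)))) ^ 2))) ^ 2 ∂P := by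
    rw [sum_range_mul_div_mod (fun s i => ∫ x, (2 * (∑ r ∈ Finset.range (i), (h (x (s + r + 1)) - kop κ h (x (s + r)))) * (h (x (s + (i) + 1)) - kop κ h (x (s + (i)))) + ((h (x (s + (i) + 1)) - kop κ h (x (s + (i)))) ^ 2 - (kop κ (fun y => h y ^ 2) (x (s + (i))) - (kop κ h (x (s + (i)))) ^ 2))) ^ 2 ∂P) a b]
  rw [integral_congr_ae (ae_of_all _ fun x => congrArg (fun r : ℝ => r ^ 2) (hL x)), hR]
  exact integral_sq_sum_eq_of_orthogonal P (fun t => measurable_sqIncr κ hh _ _)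
    (fun t x => abs_sqIncr_le κ hh hCh _ _ x) horth (a * b)

variable {π : Measure Ω} [IsProbabilityMeasure π] {A ρ : ℝ}

/-- **THE VARIANCE OF THE MARTINGALE STATISTIC IS `2m²` UP TO `O(1/√b)`**, uniformly in the start:
under the envelope there is `K ≥ 0` with
`|E_{μ₀}[(Σ_{j<a} (M_{bj,b}² − Σ_{i<b} q(X_{bj+i})))²] − 2 m² a b²| ≤ K a b √b` (`m = ∫ q dπ`) for
all `μ₀, a, b` — the CLT's variance `2m²` is attained by the second moments of `(…)/(√a b)`. -/
theorem exists_abs_chain_sqBlockMartingale_centred_sq_integral_sub_le_of_envelope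
    (henv : ∀ (g : Ω → ℝ), Measurable g → ∀ (Cg : ℝ), (∀ x, |g x| ≤ Cg) →
      ∀ (t : ℕ) (x : Ω), |(kop κ)^[t] g x - ∫ y, g y ∂π| ≤ 2 * Cg * (A * ρ ^ t))
    (hA : 0 ≤ A) (hρ0 : 0 ≤ ρ) (hρ1 : ρ < 1)
    {h : Ω → ℝ} (hh : Measurable h) {Ch : ℝ} (hCh : ∀ x, |h x| ≤ Ch) :
    ∃ K : ℝ, 0 ≤ K ∧ ∀ (μ₀ : Measure Ω) [IsProbabilityMeasure μ₀] (a b : ℕ),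
      |∫ x, (∑ j ∈ Finset.range a, ((∑ r ∈ Finset.range b, (h (x (b * j + r + 1)) - kop κ h (x (b * j + r)))) ^ 2
          - ∑ i ∈ Finset.range b, (kop κ (fun y => h y ^ 2) (x (b * j + i)) - (kop κ h (x (b * j + i))) ^ 2))) ^ 2
          ∂(Kernel.trajMeasure (X := fun _ : ℕ => Ω) (μ₀)
          (fun n : ℕ => κ.comap (fun h' : (i : ↥(Finset.Iic n)) → Ω => h' ⟨n, Finset.mem_Iic.2 le_rfl⟩)
            (measurable_pi_apply _)))
        - 2 * (∫ y, (kop κ (fun y => h y ^ 2) y - (kop κ h y) ^ 2) ∂π) ^ 2 * a * (b : ℝ) ^ 2|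
      ≤ K * a * b * Real.sqrt b := by
  obtain ⟨K, hK0, hK⟩ := exists_abs_chain_quarticVariation_integral_sub_le_of_envelope henv hA hρ0 hρ1
    hh hCh
  refine ⟨K, hK0, fun μ₀ _ a b => ?_⟩
  rw [chain_sqBlockMartingale_centred_sq_integral_eq hh hCh μ₀ a b]
  set m : ℝ := ∫ y, (kop κ (fun y => h y ^ 2) y - (kop κ h y) ^ 2) ∂π with hm
  have hblock : ∀ j ∈ Finset.range a,
      |(∑ i ∈ Finset.range b, ∫ x, (2 * (∑ r ∈ Finset.range (i), (h (x (b * j + r + 1)) - kop κ h (x (b * j + r)))) * (h (x (b * j + (i) + 1)) - kop κ h (x (b * j + (i)))) + ((h (x (b * j + (i) + 1)) - kop κ h (x (b * j + (i)))) ^ 2 - (kop κ (fun y => h y ^ 2) (x (b * j + (i))) - (kop κ h (x (b * j + (i)))) ^ 2))) ^ 2 ∂(Kernel.trajMeasure (X := fun _ : ℕ => Ω) (μ₀)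
          (fun n : ℕ => κ.comap (fun h' : (i : ↥(Finset.Iic n)) → Ω => h' ⟨n, Finset.mem_Iic.2 le_rfl⟩)
            (measurable_pi_apply _))))
        - 2 * m ^ 2 * (b : ℝ) ^ 2| ≤ K * b * Real.sqrt b := by
    intro j _
    have hint : ∀ i ∈ Finset.range b, Integrable (fun x : ℕ → Ω => (2 * (∑ r ∈ Finset.range (i), (h (x (b * j + r + 1)) - kop κ h (x (b * j + r)))) * (h (x (b * j + (i) + 1)) - kop κ h (x (b * j + (i)))) + ((h (x (b * j + (i) + 1)) - kop κ h (x (b * j + (i)))) ^ 2 - (kop κ (fun y => h y ^ 2) (x (b * j + (i))) - (kop κ h (x (b * j + (i)))) ^ 2))) ^ 2)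
        (Kernel.trajMeasure (X := fun _ : ℕ => Ω) (μ₀)
          (fun n : ℕ => κ.comap (fun h' : (i : ↥(Finset.Iic n)) → Ω => h' ⟨n, Finset.mem_Iic.2 le_rfl⟩)
            (measurable_pi_apply _))) := fun i _ =>
      integrable_of_bounded _ ((measurable_sqIncr κ hh _ _).pow_const 2)
        (C := (8 * Ch ^ 2 * ((i : ℕ) + 1)) ^ 2) fun x => by
          rw [abs_pow]; exact pow_le_pow_left₀ (abs_nonneg _) (abs_sqIncr_le κ hh hCh _ _ x) 2
    rw [← integral_finsetSum _ hint]
    exact hK μ₀ (b * j) b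
  calc |(∑ j ∈ Finset.range a, ∑ i ∈ Finset.range b, ∫ x, (2 * (∑ r ∈ Finset.range (i), (h (x (b * j + r + 1)) - kop κ h (x (b * j + r)))) * (h (x (b * j + (i) + 1)) - kop κ h (x (b * j + (i)))) + ((h (x (b * j + (i) + 1)) - kop κ h (x (b * j + (i)))) ^ 2 - (kop κ (fun y => h y ^ 2) (x (b * j + (i))) - (kop κ h (x (b * j + (i)))) ^ 2))) ^ 2 ∂(Kernel.trajMeasure (X := fun _ : ℕ => Ω) (μ₀)
          (fun n : ℕ => κ.comap (fun h' : (i : ↥(Finset.Iic n)) → Ω => h' ⟨n, Finset.mem_Iic.2 le_rfl⟩)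
            (measurable_pi_apply _))))
          - 2 * m ^ 2 * a * (b : ℝ) ^ 2|
      = |∑ j ∈ Finset.range a, ((∑ i ∈ Finset.range b, ∫ x, (2 * (∑ r ∈ Finset.range (i), (h (x (b * j + r + 1)) - kop κ h (x (b * j + r)))) * (h (x (b * j + (i) + 1)) - kop κ h (x (b * j + (i)))) + ((h (x (b * j + (i) + 1)) - kop κ h (x (b * j + (i)))) ^ 2 - (kop κ (fun y => h y ^ 2) (x (b * j + (i))) - (kop κ h (x (b * j + (i)))) ^ 2))) ^ 2 ∂(Kernel.trajMeasure (X := fun _ : ℕ => Ω) (μ₀)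
          (fun n : ℕ => κ.comap (fun h' : (i : ↥(Finset.Iic n)) → Ω => h' ⟨n, Finset.mem_Iic.2 le_rfl⟩)
            (measurable_pi_apply _))))
          - 2 * m ^ 2 * (b : ℝ) ^ 2)| := by
        rw [Finset.sum_sub_distrib, Finset.sum_const, Finset.card_range, nsmul_eq_mul]; ring_nf
    _ ≤ ∑ j ∈ Finset.range a, |(∑ i ∈ Finset.range b, ∫ x, (2 * (∑ r ∈ Finset.range (i), (h (x (b * j + r + 1)) - kop κ h (x (b * j + r)))) * (h (x (b * j + (i) + 1)) - kop κ h (x (b * j + (i)))) + ((h (x (b * j + (i) + 1)) - kop κ h (x (b * j + (i)))) ^ 2 - (kop κ (fun y => h y ^ 2) (x (b * j + (i))) - (kop κ h (x (b * j + (i)))) ^ 2))) ^ 2 ∂(Kernel.trajMeasure (X := fun _ : ℕ => Ω) (μ₀)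
          (fun n : ℕ => κ.comap (fun h' : (i : ↥(Finset.Iic n)) → Ω => h' ⟨n, Finset.mem_Iic.2 le_rfl⟩)
            (measurable_pi_apply _))))
          - 2 * m ^ 2 * (b : ℝ) ^ 2| := Finset.abs_sum_le_sum_abs _ _
    _ ≤ ∑ _j ∈ Finset.range a, K * b * Real.sqrt b := Finset.sum_le_sum hblock
    _ = K * a * b * Real.sqrt b := by rw [Finset.sum_const, Finset.card_range, nsmul_eq_mul]; ring

end SecondMoment

end Summit.Ventures.LatticeQCDFlow.Scoring

end
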